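import Literature.AlgebraicGeometry.Resolution.DefectlessDescentLimit
import Literature.AlgebraicGeometry.Resolution.GeneralizedStabilityTrdegOne
import Mathlib.FieldTheory.Normal.Closure
import HarnessLib

/-!
# Kuhlmann 2010, Cor. 2.25 (descent of defectlessness) — discharge of `Kuhlmann2010DefectlessDescent`

Topic: `Literature/AlgebraicGeometry/Resolution` (valued function fields). D-0014 keeps `Literature/`
sorry-free by stating cited results as named facts `def X : Prop`; this sibling of
`GeneralizedStabilityTrdegOne.lean` PROVES its named fact `Kuhlmann2010DefectlessDescent` =
F.-V. Kuhlmann, *Elimination of ramification I: The generalized stability theorem*, Trans. AMS 362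
(2010) 5697–5727 = arXiv:1003.5678, **Cor. 2.25** ("Take a valuation regular extension `(F|K,v)`,
fix an extension of `v` from `F` to `F̃` and assume that `(K,v)` and `(K̃.F,v)` are defectless
fields. Then also `(F,v)` is a defectless field") in the vendored case `vF/vK` torsion free and
`Fv = Kv` (valuation regular by Lemma 2.20).

## Proof (finite level; the source argues in the henselizations `K^h`, `F^h`, `(K̃.F)^h`)

Let `O = V ∩ F`, `Ω = F̃`, `K̃ ⊆ Ω` the algebraic closure of `K`, `M = K̃.F`. A finite extension of
`F` embeds into `Ω`; by `IsDefectlessIn.of_tower_top` (`DefectTowers.lean`) it suffices to show that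
`F` is defectless in every finite NORMAL `L = F(roots of r) ⊆ Ω`. By the limit step
(`exists_isDefectlessIn_adjoin_rootSet`, `DefectlessDescentLimit.lean`) there is a finite normal
`N = K(roots of p)` of `K` such that `F₁ = F·N` is `V`-defectless in `L₁ = L·F₁`; by the base step
(`isDefectlessIn_adjoin_rootSet`, `DefectlessDescentBase.lean`: Prop. 2.24 counted over all
extensions) `F` is defectless in `F₁`; since every extension of `O` to the normal extension `F₁` is
a conjugate `σ⁻¹(V ∩ F₁)` (`ValuationConjugacy.lean`) and `σ` extends to an `F`-automorphism of
`Ω` preserving `L₁`, `F₁` is defectless in `L₁` at EVERY extension of `O` (transport,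
`DefectTransport.lean`); so `F` is defectless in `L₁` (`IsDefectlessIn.tower`), hence in `L`.

## Content (everything PROVED)

* `rootSet_map_of_isScalarTower`, `normal_adjoin_rootSet_tower`, `finiteDimensional_adjoin_rootSet_tower`,
  `normal_adjoin_adjoin_rootSet`.
* `isDefectlessIn_adjoin_rootSet_of_hypotheses` — the base step under the hypotheses of the fact
  (transport from `F ≅ F(Ω) ⊆ Ω`).
* `IsDefectlessField.of_toSubfield_eq`, `isDefectlessField_adjoin_algebraicClosure` — `(K̃.F, V)`
  defectless in the rendering `K̃(F(Ω))` of the fact gives it in the rendering `F(K̃)` of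
  `DefectlessDescentLimit.lean`.
* `isDefectlessIn_of_conjugate` — defectlessness of `F₁` in `L₁` at `V` passes to every extension
  of `O` to `F₁`.
* `Kuhlmann2010DefectlessDescent_holds` — the discharge.

## Sources

* F.-V. Kuhlmann, Trans. AMS 362 (2010) = arXiv:1003.5678, §2.4, Lemma 2.20, Prop. 2.24,
  Cor. 2.25 (p. 8); §5, Lemma 5.2 (p. 19).
-/

noncomputable section

open IsLocalRing Polynomial

namespace Literature.AlgebraicGeometry.Resolution

universe u

section Tower

variable {K F Ω : Type u} [Field K] [Field F] [Field Ω] [Algebra K F] [Algebra F Ω] [Algebra K Ω]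
  [IsScalarTower K F Ω]

/-- The roots of `p ∈ K[X]` in `Ω` are the roots of its image in `F[X]`. [folklore] -/
theorem rootSet_map_of_isScalarTower (p : K[X]) : (p.map (algebraMap K F)).rootSet Ω = p.rootSet Ω := by
  unfold Polynomial.rootSet
  rw [Polynomial.aroots_def, Polynomial.aroots_def, Polynomial.map_map, ← IsScalarTower.algebraMap_eq]

variable [IsAlgClosed Ω]

/-- `F(roots of p)` is normal over `F` for `p ∈ K[X]`. [folklore] -/
theorem normal_adjoin_rootSet_tower (p : K[X]) :
    Normal F (IntermediateField.adjoin F (p.rootSet Ω) : IntermediateField F Ω) := by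
  rw [← rootSet_map_of_isScalarTower (F := F) p]
  exact normal_adjoin_rootSet (Ω := Ω) (p.map (algebraMap K F))

/-- `F(roots of p)` is finite over `F` for `p ∈ K[X]`. [folklore] -/
theorem finiteDimensional_adjoin_rootSet_tower (p : K[X]) :
    FiniteDimensional F (IntermediateField.adjoin F (p.rootSet Ω) : IntermediateField F Ω) := by
  rw [← rootSet_map_of_isScalarTower (F := F) p]
  exact finiteDimensional_adjoin_rootSet (Ω := Ω) (p.map (algebraMap K F))

/-- `L₁ = F(roots of p)(roots of r)` is normal over `F` (it is `F(roots of p) ⊔ F(roots of r)`).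
[folklore] -/
theorem normal_adjoin_adjoin_rootSet (p : K[X]) (r : F[X]) :
    Normal F (IntermediateField.adjoin (IntermediateField.adjoin F (p.rootSet Ω)) (r.rootSet Ω) :
      IntermediateField (IntermediateField.adjoin F (p.rootSet Ω)) Ω) := by
  haveI := normal_adjoin_rootSet_tower (F := F) (Ω := Ω) p
  haveI := normal_adjoin_rootSet (Ω := Ω) r
  haveI : Normal F (IntermediateField.adjoin F (p.rootSet Ω) ⊔ IntermediateField.adjoin F (r.rootSet Ω) :
      IntermediateField F Ω) := IntermediateField.normal_sup F Ω _ _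
  have h : (IntermediateField.adjoin (IntermediateField.adjoin F (p.rootSet Ω)) (r.rootSet Ω)).restrictScalars F =
      IntermediateField.adjoin F (p.rootSet Ω) ⊔ IntermediateField.adjoin F (r.rootSet Ω) := by
    rw [IntermediateField.adjoin_adjoin_left, IntermediateField.adjoin_union]
  have hN : Normal F ((IntermediateField.adjoin (IntermediateField.adjoin F (p.rootSet Ω))
      (r.rootSet Ω)).restrictScalars F) := by rw [h]; infer_instance
  exact hN

end Tower

/-! ### The base step under the hypotheses of the fact -/

section BaseStep

variable {K F Ω : Type u} [Field K] [Field F] [Field Ω] [Algebra K F] [Algebra F Ω] [Algebra K Ω]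
  [IsScalarTower K F Ω] [IsAlgClosed Ω] [Algebra.IsAlgebraic F Ω] (V : ValuationSubring Ω)

/-- **The base step of Cor. 2.25 for `F` itself**: under the hypotheses of
`Kuhlmann2010DefectlessDescent` — `vF/vK` torsion free, `Fv = Kv`, `(K, V ∩ K)` defectless —,
`(F, V ∩ F)` is defectless in `F(roots of p)` for every `p ∈ K[X]`. PROVED: the base step
`isDefectlessIn_adjoin_rootSet` (`DefectlessDescentBase.lean`) for the subfield `F(Ω) ⊆ Ω`,
transported along `F ≅ F(Ω)` (`IsDefectlessIn.congr`). [cite: Kuhlmann2010, Prop. 2.24 and Cor. 2.25] -/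
theorem isDefectlessIn_adjoin_rootSet_of_hypotheses (p : K[X])
    (hTF : ∀ a : F, a ≠ 0 → ∀ n : ℕ, 0 < n →
      (∃ c : K, (V.comap (algebraMap F Ω)).valuation a ^ n =
        (V.comap (algebraMap F Ω)).valuation (algebraMap K F c)) →
      ∃ c : K, (V.comap (algebraMap F Ω)).valuation a =
        (V.comap (algebraMap F Ω)).valuation (algebraMap K F c))
    (hRes : residueSubfield K (V.comap (algebraMap F Ω)) = ⊤)
    (hDK : IsDefectlessField K ((V.comap (algebraMap F Ω)).comap (algebraMap K F))) :
    IsDefectlessIn F (V.comap (algebraMap F Ω))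
      (IntermediateField.adjoin F (p.rootSet Ω) : IntermediateField F Ω) := by
  classical
  set O : ValuationSubring F := V.comap (algebraMap F Ω) with hO
  -- `F ≅ F₀ = F(Ω) ⊆ Ω`
  set φK : F →ₐ[K] Ω := IsScalarTower.toAlgHom K F Ω with hφK
  set F₀ : IntermediateField K Ω := IntermediateField.map φK ⊤ with hF₀
  let e : F ≃ₐ[K] F₀ := IntermediateField.topEquiv.symm.trans (IntermediateField.equivMap ⊤ φK)
  have he : ∀ x : F, ((e x : F₀) : Ω) = algebraMap F Ω x := fun x => rfl
  have hrange : Set.range (algebraMap F₀ Ω) = Set.range (algebraMap F Ω) := by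
    ext y
    constructor
    · rintro ⟨x, rfl⟩
      refine ⟨e.symm x, ?_⟩
      rw [← he, AlgEquiv.apply_symm_apply]; rfl
    · rintro ⟨x, rfl⟩
      exact ⟨e x, he x⟩
  -- `Ω` is algebraic over `F₀`
  letI : Algebra F F₀ := (e : F →ₐ[K] F₀).toRingHom.toAlgebra
  haveI : IsScalarTower F F₀ Ω := IsScalarTower.of_algebraMap_eq fun x => (he x).symm
  haveI : Algebra.IsAlgebraic F₀ Ω := Algebra.IsAlgebraic.tower_top (K := F) F₀
  -- the hypotheses in ambient form
  have hTF₀ : ∀ γ : (V.ValueGroup)ˣ, γ ∈ valueSubgroup F₀ V → ∀ n : ℕ, 0 < n →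
      γ ^ n ∈ valueSubgroup K V → γ ∈ valueSubgroup K V := by
    intro γ hγ n hn hγn
    rw [valueSubgroup_eq_of_range_eq V hrange] at hγ
    obtain ⟨a, ha0, hγa⟩ := (mem_valueSubgroup_iff F V γ).mp hγ
    obtain ⟨c, hc0, hγc⟩ := (mem_valueSubgroup_iff K V _).mp hγn
    have h1 : O.valuation a ^ n = O.valuation (algebraMap K F c) := by
      apply valueGroupHom_injective F V
      rw [map_pow, valueGroupHom_valuation, valueGroupHom_valuation, ← hγa, ← Units.val_pow_eq_pow_val,
        hγc, ← IsScalarTower.algebraMap_apply]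
    obtain ⟨c', hc'⟩ := hTF a ha0 n hn ⟨c, h1⟩
    have h2 : V.valuation (algebraMap F Ω a) = V.valuation (algebraMap K Ω c') := by
      rw [IsScalarTower.algebraMap_apply K F Ω, ← valueGroupHom_valuation F V, hc',
        valueGroupHom_valuation]
    refine (mem_valueSubgroup_iff K V γ).mpr ⟨c', ?_, by rw [hγa, h2]⟩
    rintro rfl
    rw [map_zero, map_zero] at h2
    rw [h2] at hγa
    exact γ.ne_zero hγa
  have hRes₀ : residueSubfield F₀ V ≤ residueSubfield K V := by
    rw [residueSubfield_eq_of_range_eq V hrange]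
    intro r hr
    obtain ⟨a, ha, rfl⟩ := (mem_residueSubfield_iff F V r).mp hr
    have haO : a ∈ O := ha
    have hmem : residue O ⟨a, haO⟩ ∈ residueSubfield K O := by rw [hRes]; exact Subfield.mem_top _
    obtain ⟨c, hc, hcr⟩ := (mem_residueSubfield_iff K O _).mp hmem
    have h := congrArg (residueFieldHom F V) hcr
    rw [residueFieldHom_residue, residueFieldHom_residue] at h
    have hcV : algebraMap K Ω c ∈ V := by rw [IsScalarTower.algebraMap_apply K F Ω]; exact hc
    refine (mem_residueSubfield_iff K V _).mpr ⟨c, hcV, ?_⟩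
    calc residue V ⟨algebraMap K Ω c, hcV⟩
        = residue V (comapSubringHom F V ⟨algebraMap K F c, hc⟩) :=
          congrArg (residue V) (Subtype.ext (IsScalarTower.algebraMap_apply K F Ω c))
      _ = residue V (comapSubringHom F V ⟨a, haO⟩) := h
      _ = residue V ⟨algebraMap F Ω a, ha⟩ := congrArg (residue V) (Subtype.ext rfl)
  have hDK' : IsDefectlessField K (V.comap (algebraMap K Ω)) := by
    rw [hO, ValuationSubring.comap_comap, ← IsScalarTower.algebraMap_eq K F Ω] at hDK
    exact hDK
  -- the base step over `F₀`
  have hB := isDefectlessIn_adjoin_rootSet F₀ p V hTF₀ hRes₀ hDK'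
  -- transport along `F₀ ≅ F`, `F₀(roots of p) = F(roots of p)`
  have hcarrier : (IntermediateField.adjoin F₀ (p.rootSet Ω) : IntermediateField F₀ Ω).toSubfield =
      (IntermediateField.adjoin F (p.rootSet Ω) : IntermediateField F Ω).toSubfield := by
    rw [IntermediateField.adjoin_toSubfield, IntermediateField.adjoin_toSubfield, hrange]
  let ψ : (IntermediateField.adjoin F₀ (p.rootSet Ω) : IntermediateField F₀ Ω) ≃+*
      (IntermediateField.adjoin F (p.rootSet Ω) : IntermediateField F Ω) := RingEquiv.subfieldCongr hcarrier
  have hψ : ∀ y, ((ψ y : (IntermediateField.adjoin F (p.rootSet Ω) : IntermediateField F Ω)) : Ω) = (y : Ω) :=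
    fun y => rfl
  refine IsDefectlessIn.congr (e.symm : F₀ ≃+* F) ψ (fun x => ?_) ?_ hB
  · apply Subtype.ext
    rw [hψ, IntermediateField.coe_algebraMap_apply, IntermediateField.coe_algebraMap_apply,
      IntermediateField.algebraMap_apply]
    change (x : Ω) = algebraMap F Ω (e.symm x)
    rw [← he, AlgEquiv.apply_symm_apply]
  · ext x
    rw [ValuationSubring.mem_comap, ValuationSubring.mem_comap, hO, ValuationSubring.mem_comap]
    change (x : Ω) ∈ V ↔ algebraMap F Ω (e.symm x) ∈ V
    rw [← he, AlgEquiv.apply_symm_apply]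

end BaseStep

/-! ### The compositum `K̃.F` in the two renderings -/

section Compositum

variable {Ω : Type u} [Field Ω] (V : ValuationSubring Ω)

/-- Intermediate fields of `Ω` over two base fields with the same underlying subfield are the same
valued field: defectlessness transports. [folklore] -/
theorem IsDefectlessField.of_toSubfield_eq {A B : Type u} [Field A] [Field B] [Algebra A Ω] [Algebra B Ω]
    (M₁ : IntermediateField A Ω) (M₂ : IntermediateField B Ω) (hM : M₁.toSubfield = M₂.toSubfield)
    (h : IsDefectlessField M₁ (V.comap (algebraMap M₁ Ω))) :
    IsDefectlessField M₂ (V.comap (algebraMap M₂ Ω)) := by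
  let φ : M₁ ≃+* M₂ := RingEquiv.subfieldCongr hM
  have hφ : ∀ x : M₁, ((φ x : M₂) : Ω) = (x : Ω) := fun x => rfl
  refine IsDefectlessField.congr φ ?_ h
  ext x
  rw [ValuationSubring.mem_comap, ValuationSubring.mem_comap, ValuationSubring.mem_comap,
    IntermediateField.algebraMap_apply, IntermediateField.algebraMap_apply]
  change (x : Ω) ∈ V ↔ ((φ x : M₂) : Ω) ∈ V
  rw [hφ]

variable {K F : Type u} [Field K] [Field F] [Algebra F Ω] [Algebra K Ω]

/-- The compositum `K̃.F ⊆ Ω` as `K̃(F(Ω))` (the rendering of `Kuhlmann2010DefectlessDescent`) and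
as `F(K̃)` (the rendering of `DefectlessDescentLimit.lean`) have the same underlying subfield.
[folklore] -/
theorem adjoin_algebraicClosure_toSubfield_eq :
    (IntermediateField.adjoin (algebraicClosure K Ω) (Set.range (algebraMap F Ω)) :
      IntermediateField (algebraicClosure K Ω) Ω).toSubfield =
    (IntermediateField.adjoin F ((algebraicClosure K Ω : IntermediateField K Ω) : Set Ω) :
      IntermediateField F Ω).toSubfield := by
  rw [IntermediateField.adjoin_toSubfield, IntermediateField.adjoin_toSubfield,
    coe_range_algebraMap_intermediateField (Ω := Ω) (algebraicClosure K Ω), Set.union_comm]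

/-- `(K̃.F, V ∩ K̃.F)` defectless in the rendering of the fact gives it in the rendering `F(K̃)`.
[folklore] -/
theorem isDefectlessField_adjoin_algebraicClosure
    (h : IsDefectlessField (IntermediateField.adjoin (algebraicClosure K Ω) (Set.range (algebraMap F Ω)))
      (V.comap (algebraMap
        (IntermediateField.adjoin (algebraicClosure K Ω) (Set.range (algebraMap F Ω))) Ω))) :
    IsDefectlessField (IntermediateField.adjoin F ((algebraicClosure K Ω : IntermediateField K Ω) : Set Ω) :
        IntermediateField F Ω)
      (V.comap (algebraMap (IntermediateField.adjoin F
        ((algebraicClosure K Ω : IntermediateField K Ω) : Set Ω) : IntermediateField F Ω) Ω)) :=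
  IsDefectlessField.of_toSubfield_eq V _ _ (adjoin_algebraicClosure_toSubfield_eq (K := K) (F := F)) h

end Compositum

/-! ### Defectlessness of `F₁` in `L₁` at every extension of `O` -/

section Conjugate

variable {F Ω : Type u} [Field F] [Field Ω] [Algebra F Ω] [IsAlgClosed Ω] [Algebra.IsAlgebraic F Ω]
  (V : ValuationSubring Ω)

/-- **From one extension to all**: let `F₁ ⊆ Ω` be finite normal over `F` and `L₁` an intermediate
field of `Ω / F₁`, normal over `F`. If `(F₁, V ∩ F₁)` is defectless in `L₁`, then so is `(F₁, O₁)`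
for every valuation ring `O₁` of `F₁` over `V ∩ F`: `O₁ = σ⁻¹(V ∩ F₁)` for an `F`-automorphism `σ`
of `F₁` (`exists_algEquiv_comap_eq`), which extends to an `F`-automorphism of `Ω` preserving `L₁`,
an isomorphism of valued fields `(F₁, V ∩ F₁, L₁) ≅ (F₁, O₁, L₁)` (`IsDefectlessIn.congr`).
[folklore] -/
theorem isDefectlessIn_of_conjugate (F₁ : IntermediateField F Ω) [FiniteDimensional F F₁] [Normal F F₁]
    (L₁ : IntermediateField F₁ Ω) [Normal F L₁]
    (h : IsDefectlessIn F₁ (V.comap (algebraMap F₁ Ω)) L₁) (O₁ : ValuationSubring F₁)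
    (hO₁ : O₁.comap (algebraMap F F₁) = V.comap (algebraMap F Ω)) :
    IsDefectlessIn F₁ O₁ L₁ := by
  haveI : IsAlgClosure F Ω := ⟨inferInstance, inferInstance⟩
  haveI : Normal F Ω := IsAlgClosure.normal F Ω
  set W₁ : ValuationSubring F₁ := V.comap (algebraMap F₁ Ω) with hW₁def
  have hW₁ : W₁.comap (algebraMap F F₁) = V.comap (algebraMap F Ω) := by
    ext a
    rw [ValuationSubring.mem_comap, hW₁def, ValuationSubring.mem_comap, ValuationSubring.mem_comap,
      ← IsScalarTower.algebraMap_apply]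
  -- `O₁ = σ⁻¹(W₁)`
  obtain ⟨σ, hσ⟩ := exists_algEquiv_comap_eq F W₁ O₁ (hW₁.trans hO₁.symm)
  -- `σ` extends to `Ω` and restricts to `L₁`
  haveI : IsScalarTower F L₁ Ω := IsScalarTower.of_algebraMap_eq fun x => by
    rw [IntermediateField.algebraMap_apply]; rfl
  set τ : Ω ≃ₐ[F] Ω := (σ.liftNormal Ω).symm with hτ
  have hτF₁ : ∀ x : F₁, τ (x : Ω) = ((σ.symm x : F₁) : Ω) := by
    intro x
    rw [hτ, AlgEquiv.symm_apply_eq]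
    have h1 := σ.liftNormal_commutes Ω (σ.symm x)
    rw [AlgEquiv.apply_symm_apply, IntermediateField.algebraMap_apply,
      IntermediateField.algebraMap_apply] at h1
    exact h1.symm
  set ψ : L₁ ≃ₐ[F] L₁ := τ.restrictNormal L₁ with hψ
  have hψcoe : ∀ y : L₁, ((ψ y : L₁) : Ω) = τ (y : Ω) := by
    intro y
    have h1 := τ.restrictNormal_commutes L₁ y
    rw [IntermediateField.algebraMap_apply, IntermediateField.algebraMap_apply] at h1
    exact h1
  -- transport along `(σ⁻¹, ψ)`
  refine IsDefectlessIn.congr (σ.symm : F₁ ≃ₐ[F] F₁).toRingEquiv ψ.toRingEquiv (fun x => ?_) ?_ h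
  · apply Subtype.ext
    change ((ψ (algebraMap F₁ L₁ x) : L₁) : Ω) = ((algebraMap F₁ L₁ (σ.symm x) : L₁) : Ω)
    rw [hψcoe]
    have h2 : ((algebraMap F₁ L₁ x : L₁) : Ω) = (x : Ω) := by
      rw [← IntermediateField.algebraMap_apply L₁, ← IsScalarTower.algebraMap_apply,
        IntermediateField.algebraMap_apply]
    have h3 : ((algebraMap F₁ L₁ (σ.symm x) : L₁) : Ω) = ((σ.symm x : F₁) : Ω) := by
      rw [← IntermediateField.algebraMap_apply L₁, ← IsScalarTower.algebraMap_apply,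
        IntermediateField.algebraMap_apply]
    rw [h2, h3, hτF₁]
  · rw [← hσ]
    ext x
    rw [ValuationSubring.mem_comap, ValuationSubring.mem_comap, ValuationSubring.mem_comap]
    change x ∈ W₁ ↔ σ (σ.symm x) ∈ W₁
    rw [AlgEquiv.apply_symm_apply]

end Conjugate

/-! ### The discharge -/

section Main

/-- **Kuhlmann 2010, Cor. 2.25 for `vF/vK` torsion free and `Fv = Kv`** — DISCHARGE of the named
fact `Kuhlmann2010DefectlessDescent` (`GeneralizedStabilityTrdegOne.lean`): if `(K, v)` and
`(K̃.F, v)` are defectless fields, so is `(F, v)`. PROVED at finite level (see the module docstring),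
the source arguing through the henselizations (Thm. 2.14, Cor. 2.21, Prop. 2.24, Lemma 2.13 and
Lemma 2.3 of [K6]). [cite: Kuhlmann2010, Cor. 2.25 and Lemma 2.20] -/
theorem Kuhlmann2010DefectlessDescent_holds : Kuhlmann2010DefectlessDescent.{u} := by
  intro K F Ω _ _ _ _ _ _ _ _ O V hVO hTF hRes hDK hDM
  classical
  subst hVO
  haveI : IsAlgClosed Ω := IsAlgClosure.isAlgClosed F
  haveI : Algebra.IsAlgebraic F Ω := IsAlgClosure.isAlgebraic
  haveI : Normal F Ω := IsAlgClosure.normal F Ω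
  -- `(K̃.F, V)` defectless in the rendering `F(K̃)`
  have hDM' := isDefectlessField_adjoin_algebraicClosure V hDM
  -- core: `F` is defectless in every finite normal `F(roots of r) ⊆ Ω`
  have core : ∀ r : F[X], IsDefectlessIn F (V.comap (algebraMap F Ω))
      (IntermediateField.adjoin F (r.rootSet Ω) : IntermediateField F Ω) := by
    intro r
    obtain ⟨p, hC⟩ := exists_isDefectlessIn_adjoin_rootSet V r hDM'
    set F₁ : IntermediateField F Ω := IntermediateField.adjoin F (p.rootSet Ω) with hF₁def
    set L₁ : IntermediateField F₁ Ω := IntermediateField.adjoin F₁ (r.rootSet Ω) with hL₁def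
    haveI : FiniteDimensional F F₁ := finiteDimensional_adjoin_rootSet_tower (F := F) (Ω := Ω) p
    haveI : Normal F F₁ := normal_adjoin_rootSet_tower (F := F) (Ω := Ω) p
    haveI : FiniteDimensional F₁ L₁ := finiteDimensional_adjoin_rootSet_intermediateField F₁ r
    haveI : Normal F L₁ := normal_adjoin_adjoin_rootSet (F := F) (Ω := Ω) p r
    -- base step: `F` defectless in `F₁`; with the limit step at every extension: in `L₁`
    have hA : IsDefectlessIn F (V.comap (algebraMap F Ω)) F₁ :=
      isDefectlessIn_adjoin_rootSet_of_hypotheses V p hTF hRes hDK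
    have hT : IsDefectlessIn F (V.comap (algebraMap F Ω)) L₁ :=
      IsDefectlessIn.tower (V.comap (algebraMap F Ω)) hA fun O₁ hO₁ =>
        isDefectlessIn_of_conjugate V F₁ L₁ hC O₁ hO₁
    -- down to `F(roots of r) ⊆ L₁`
    have hle : (IntermediateField.adjoin F (r.rootSet Ω) : IntermediateField F Ω) ≤ L₁.restrictScalars F := by
      rw [hL₁def, hF₁def, IntermediateField.adjoin_adjoin_left]
      exact IntermediateField.adjoin.mono F _ _ Set.subset_union_right
    letI : Algebra (IntermediateField.adjoin F (r.rootSet Ω) : IntermediateField F Ω) L₁ :=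
      (IntermediateField.inclusion hle).toRingHom.toAlgebra
    haveI : IsScalarTower F (IntermediateField.adjoin F (r.rootSet Ω) : IntermediateField F Ω) L₁ :=
      IsScalarTower.of_algebraMap_eq fun x => Subtype.ext (by
        change ((algebraMap F L₁ x : L₁) : Ω) =
          ((IntermediateField.inclusion hle (algebraMap F (IntermediateField.adjoin F (r.rootSet Ω)) x) :
            L₁.restrictScalars F) : Ω)
        rw [IntermediateField.coe_inclusion, IntermediateField.coe_algebraMap_apply]
        rfl)
    haveI : FiniteDimensional F (IntermediateField.adjoin F (r.rootSet Ω) : IntermediateField F Ω) :=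
      finiteDimensional_adjoin_rootSet (Ω := Ω) r
    haveI : Module.Finite F L₁ := Module.Finite.trans F₁ L₁
    haveI : FiniteDimensional (IntermediateField.adjoin F (r.rootSet Ω) : IntermediateField F Ω) L₁ :=
      Module.Finite.of_restrictScalars_finite F _ L₁
    exact IsDefectlessIn.of_tower_top (V.comap (algebraMap F Ω)) hT
  -- an arbitrary finite extension `L` of `F` embeds into `Ω`
  intro L _ _ hfin
  haveI := hfin
  let φ : L →ₐ[F] Ω := IsAlgClosed.lift
  set L' : IntermediateField F Ω := IntermediateField.map φ ⊤ with hL'def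
  let eL : L ≃ₐ[F] L' := IntermediateField.topEquiv.symm.trans (IntermediateField.equivMap ⊤ φ)
  haveI : FiniteDimensional F L' := LinearEquiv.finiteDimensional eL.toLinearEquiv
  -- its normal closure is `F(roots of r)` for some `r`
  set Lc : IntermediateField F Ω := IntermediateField.normalClosure F L' Ω with hLcdef
  haveI : FiniteDimensional F Lc := normalClosure.is_finiteDimensional F L' Ω
  haveI : Normal F Lc := normalClosure.normal F L' Ω
  obtain ⟨r, hr⟩ := Normal.exists_isSplittingField F Lc
  have hLc : Lc = IntermediateField.adjoin F (r.rootSet Ω) := (IntermediateField.isSplittingField_iff.mp hr).2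
  have hcoreLc : IsDefectlessIn F (V.comap (algebraMap F Ω)) Lc := by
    rw [hLc]; exact core r
  -- down to `L'`, then to `L`
  have hle' : L' ≤ Lc := IntermediateField.le_normalClosure L'
  letI : Algebra L' Lc := (IntermediateField.inclusion hle').toRingHom.toAlgebra
  haveI : IsScalarTower F L' Lc :=
    IsScalarTower.of_algebraMap_eq fun x => Subtype.ext (by
      change ((algebraMap F Lc x : Lc) : Ω) = ((IntermediateField.inclusion hle' (algebraMap F L' x) : Lc) : Ω)
      rw [IntermediateField.coe_inclusion, IntermediateField.coe_algebraMap_apply,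
        IntermediateField.coe_algebraMap_apply])
  haveI : FiniteDimensional L' Lc := Module.Finite.of_restrictScalars_finite F L' Lc
  have hL' : IsDefectlessIn F (V.comap (algebraMap F Ω)) L' := IsDefectlessIn.of_tower_top _ hcoreLc
  refine IsDefectlessIn.congr (RingEquiv.refl F) (eL.symm : L' ≃ₐ[F] L).toRingEquiv (fun x => ?_) ?_ hL'
  · change eL.symm (algebraMap F L' x) = algebraMap F L x
    rw [← eL.symm.commutes x]
  · ext x
    simp [ValuationSubring.mem_comap]

end Main

end Literature.AlgebraicGeometry.Resolution
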